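import Summits.QuantumFields.BalabanUV.T4Continuum.Support.NE3EnergyWeightedSupShape
import Summits.QuantumFields.BalabanUV.T4Continuum.Support.NE3LocalCrudeWPair

/-!
# NE7EtaSupFromEnergy — route #1 of the NE7 crux, hardest stub S1∕L7b (background coordinate) and stub S2: what row NE3's
# ENERGY conjunct gives POINTWISE — the ℓ² → sup interpolation on `ℤ^d` cubes for the two-run discrepancy direction `Z` and
# its dressed curl, with the cube side left free (the consumer optimises it)

Cell `pub-balaban`, rung (B)+1 sub-cell t4, lineage `b2b-balaban-t4-ne7-p1` (node U5 = NE7), generation 21 = CRUX PROVER NE7 #1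
under ruling e34b3e0c; crux skeleton `t4/skeletons/NE7-CRUX-R1.md` (v1.5, this generation) rows S1∕L7b and S2; record
`HOME/t4/b2b-balaban-t4-ne7-p1-g21/ROUTE1-NE7.md`.  HONEST FRAMING (page 1): FIXED FINITE T⁴, rung (B)+1; NE7, NE3 are NOT PRINTED
in [Balaban1984PropagatorsI]–[Balaban1989LargeFieldII] and NOT PROVED here; continuum YM on T⁴ ⇐ BetaPertH ∧ nine spine estimates
(0/9 proved); BetaPertH ⇐ (D1) ∧ (D4) ∧ CAP+tail; G-an2-4 gates asym, D1 and NE2/3/4; NOT infinite volume, NOT mass gap, NOT Clay.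

WHY THIS FILE.  Route #1's U-slot (the Cauchy step `T4TowerRateDischarge.lipBackground_of_analyticMargin` in the printed
analyticity spaces `U^c_j(X, α₀, α₁)` of [Balaban1987RG1] (1.11)–(1.16) p. 262: plaquette deviations `< α₀ξ²`, `ξ = L^{−j}`)
needs the two runs' backgrounds — run A's level-`k` minimiser `UA` and the once-averaged run-B minimiser `rescale L (bavg L UB)` —
to be close POINTWISE, in plaquette units, relative to the margin `βα₀(g_k)ξ²`.  Row NE3's live root T-E_w♯
(`NE3EnergyWeightedSupShape.NE3EnergyRateWSup`) represents the pair as `gaugeAct u UA = vary W Z 1`, `W = rescale L (bavg L UB)`,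
with (E) the η-WEIGHTED ENERGY bound `energyNormW L k W Z (periodBox (N L^k)) ≤ C·residualScale d L N b g k`
(`energyNormW² = Σ_p ‖(d_W Z)(p)‖² + (L^k)⁻²·Σ_b ‖Z(b)‖²`; at `d = 4`, `residualScale ≈ wallConst·N²·L^{−k}·(√g·dualC2∕L + …)`)
and (S) the SUP conjunct `‖Z(b)‖ ≤ s·(L⁻¹)^k`.  CURRENCY CENSUS (this lineage, gen 21; arithmetic on the displayed shapes, no new
estimate): (S) is in BOND units — with `Z = ξ·a` (`a` = the discrepancy of the potentials in field units) it says `‖a‖_∞ ≤ s`, i.e.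
BOUNDEDNESS (the printed regularity TYPE of [Balaban1985Variational] Thm 1 (9) p. 279), NOT a rate; the dressed curl it yields is
`‖d_W Z‖ ≤ 4sξ`, which against the margin `βα₀ξ²` DIVERGES like `L^k`.  (E) instead IS a rate, but in ℓ²: over the `(N L^k)^d`
sites, RMS`(d_W Z) ≲ C·residualScale_k ∕ (N L^k)^{d/2} ≈ √g·ξ³` at `d = 4` — ONE power of `ξ` below the margin (`rate L⁻¹` in RMS,
the log-loss of `α₀(g_k) = C₀g_k(log g_k^{−2})^{q₀}` (2.28) aside); likewise RMS`(Z) ≈ √g·ξ²∕L`.  What converts RMS into SUP is an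
interior estimate for the DIFFERENCE of two minimisers — NOT PRINTED ([Balaban1985Variational] Prop. 9 ∕ Thm 1 are one-run) —
or, elementarily and with a loss, the lattice interpolation «ℓ² + step-Lipschitz ⇒ sup» of the NE2 leaf `LatticeSupFromEnergy`
(on the torus `Π ℤ∕N_μ`; cell GAPS G-ne2leaf08g2-1, closer (M1″)).  THIS FILE proves that interpolation on `ℤ^d` CUBES (no torus
plumbing: the hypothesis is `Finset.Icc y₀ (y₀ + r) ⊆ F`) and applies it to `Z(·, κ)` and to `(d_W Z)(·, π)` against `energyNormW`:
 * §1 (adapted from `LatticeSupFromEnergy`, leaf-08 of the NE2 swarm — same elementary argument, re-proved on `Site d = Fin d → ℤ`):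
   `norm_sub_le_of_nsmul_e`, `norm_sub_partial_le`, `cubePt_apply`∕`_injective`∕`_mem_Icc`, **`card_mul_sq_le_sum_sq`**
   (`(r+1)^d·(‖f x₀‖ − 2d·r·λ)² ≤ Σ_{x ∈ F} ‖f x‖²` for a step-Lipschitz `f` and ANY cube of side `r` inside `F` CONTAINING `x₀` —
   factor `2` because the cube is not anchored at `x₀`), **`norm_le_of_stepLipschitz_of_sum_sq`**
   (`‖f x₀‖ ≤ 2d·r·λ + √(Σ_F ‖f‖²)∕√((r+1)^d)`);
 * §2 the energy norm dominates the two ℓ² sums (`sum_sq_dir_le`, `sum_sq_curl_le`; `curlSq_le_energyNormW_sq` ∕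
   `dirSq_le_pow_sq_mul_energyNormW_sq` are row NE3's, `NE3LocalCrudeWPair`, imported) and the TWO POINTWISE BOUNDS **`norm_dir_le_of_energyNormW`**
   (`‖Z x₀ κ‖ ≤ 2d·r·λ + L^k·E∕√((r+1)^d)`) and **`norm_curl_le_of_energyNormW`** (`‖(d_W Z)(x₀, π)‖ ≤ 2d·r·λ′ + E∕√((r+1)^d)`),
   `E = energyNormW L k W Z F`, for every cube of side `r` inside `F` containing `x₀`, `λ`∕`λ′` the step-Lipschitz constants of
   `Z(·, κ)`∕`(d_W Z)(·, π)` — DISPLAYED HYPOTHESES (regular-gauge TYPE bounds on the discrepancy direction; for the ∃-bound pair of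
   T-E_w♯ they must be conjuncts of the root, exactly as the sup conjunct was added in T-E_w♯ — see §3's docstring);
 * §3 BY NAME from T-E_w♯: `pointwise_of_ne3EnergyRateWSup` threads §2 through the root's `∃(u, Z)` with `E ≤ C·residualScale`.
EXPONENT COUNT (prose, the consumer's optimisation; d = 4, ξ = L^{−k}): with `λ′ = Λ₂ξ³` (second covariant differences of `a`
bounded — regular-gauge TYPE, cf. [Balaban1985GaugeFixing]) and `E ≈ c·N²√g·ξ`, the choice `r + 1 ≈ ρL^k`,
`ρ³ ≈ cN²√g·ξ∕Λ₂`, gives `sup_p ‖d_W Z‖ ≲ ξ²·(cN²√g)^{1/3}Λ₂^{2/3}·ξ^{1/3}` — relative to `βα₀(g_k)ξ²` a GEOMETRIC rate `L^{−1/3}` times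
the polynomial∕log loss of `α₀(g_k)`, which route #1 tolerates (`T4TowerRateDischarge` §3: any common rate `< 1`; `summable_polyRate`).
The second-order term of the plaquette discrepancy `∂(W e^Z)(∂W)⁻¹ − 1 − d_W Z = O(Σ_{b∈∂p}‖Z_b‖²)` needs `sup‖Z‖² ≪ ξ²`, which the
same interpolation on `Z` (λ = Λ₁ξ²) gives as `ξ^{8/3}` — also below the margin.  NONE of this is asserted as a theorem about
Bałaban's minimisers: T-E_w♯ is row NE3's unproved target shape, the Lipschitz conjuncts are hypotheses, the optimisation is prose.

WHAT THIS FILE IS NOT.  Not NE3, not NE7, not the interior regularity of differences; not `LatticeSupFromEnergy` re-filed (that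
file is on the torus and stays the closer of (M1″) for NE2); no `def`, no `sorry`, nothing printed is a hypothesis of a theorem.
[folklore] throughout.
-/

set_option autoImplicit false

open scoped BigOperators Matrix Matrix.Norms.L2Operator
open Finset

namespace Summit.QuantumFields.BalabanUV.T4Continuum.NE7EtaSupFromEnergy

open Literature.MathematicalPhysics.QuantumFieldTheory.Balaban1983to89
open B7Prop1Explicit B7Prop2Explicit
open T4AveragingDeficitWall hiding Site Plane Plaq Bond
open T4AveragingDeficitWallBoundary (periodBox)
open AveragingDeficitPeriodicCounting (IsPeriodicDir)
open MinimalActionSandwich (IsMinimiser)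
open MinimalActionRate (Regular)
open NE3EnergyShapes (residualScale residualScale_nonneg IsUnitarySite IsPeriodicSite)
open NE3EnergyWeightedShapes (energyNormW energyNormW_nonneg)
open NE3EnergyWeightedSupShape (NE3EnergyRateWSup)
open NE3LocalCrudeWPair (curlSq_le_energyNormW_sq dirSq_le_pow_sq_mul_energyNormW_sq)

noncomputable section

/-! ## §1 The ℓ² → sup interpolation on `ℤ^d` cubes (adapted from `LatticeSupFromEnergy`) -/

section Lattice

variable {d : ℕ} {E : Type*} [SeminormedAddCommGroup E]

/-- **`n` LATTICE STEPS IN DIRECTION `μ` COST AT MOST `n·λ`** (on `ℤ^d`). [folklore] -/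
theorem norm_sub_le_of_nsmul_e (f : Site d → E) {lam : ℝ} (hlip : ∀ (x : Site d) (μ : Fin d), ‖f (x + e μ) - f x‖ ≤ lam)
    (x : Site d) (μ : Fin d) : ∀ n : ℕ, ‖f (x + n • e μ) - f x‖ ≤ n * lam
  | 0 => by simp
  | n + 1 => by
    have ih := norm_sub_le_of_nsmul_e f hlip x μ n
    have hstep := hlip (x + n • e μ) μ
    rw [succ_nsmul, ← add_assoc]
    calc ‖f (x + n • e μ + e μ) - f x‖
        = ‖(f (x + n • e μ + e μ) - f (x + n • e μ)) + (f (x + n • e μ) - f x)‖ := by congr 1; abel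
      _ ≤ lam + n * lam := (norm_add_le _ _).trans (add_le_add hstep ih)
      _ = (n + 1 : ℕ) * lam := by push_cast; ring

/-- partial cube diagonals: `‖f (y₀ + Σ_{μ ∈ s} v_μ • e_μ) − f y₀‖ ≤ λ · Σ_{μ ∈ s} v_μ`. [folklore] -/
theorem norm_sub_partial_le (f : Site d → E) {lam : ℝ} (hlip : ∀ (x : Site d) (μ : Fin d), ‖f (x + e μ) - f x‖ ≤ lam)
    (y₀ : Site d) (v : Fin d → ℕ) (s : Finset (Fin d)) :
    ‖f (y₀ + ∑ μ ∈ s, v μ • e μ) - f y₀‖ ≤ lam * ∑ μ ∈ s, (v μ : ℝ) := by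
  classical
  induction s using Finset.induction_on with
  | empty => simp
  | @insert μ s hμ ih =>
    rw [Finset.sum_insert hμ, Finset.sum_insert hμ, add_comm (v μ • e μ), ← add_assoc, mul_add]
    have hstep := norm_sub_le_of_nsmul_e f hlip (y₀ + ∑ μ ∈ s, v μ • e μ) μ (v μ)
    calc ‖f (y₀ + ∑ μ ∈ s, v μ • e μ + v μ • e μ) - f y₀‖
        = ‖(f (y₀ + ∑ μ ∈ s, v μ • e μ + v μ • e μ) - f (y₀ + ∑ μ ∈ s, v μ • e μ))
            + (f (y₀ + ∑ μ ∈ s, v μ • e μ) - f y₀)‖ := by congr 1; abel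
      _ ≤ (v μ : ℝ) * lam + lam * ∑ μ ∈ s, (v μ : ℝ) := (norm_add_le _ _).trans (add_le_add hstep ih)
      _ = lam * (v μ : ℝ) + lam * ∑ μ ∈ s, (v μ : ℝ) := by ring

/-- the full cube diagonal: `‖f (y₀ + Σ_μ v_μ • e_μ) − f y₀‖ ≤ λ · Σ_μ v_μ`. [folklore] -/
theorem norm_sub_cubePt_le (f : Site d → E) {lam : ℝ} (hlip : ∀ (x : Site d) (μ : Fin d), ‖f (x + e μ) - f x‖ ≤ lam)
    (y₀ : Site d) (v : Fin d → ℕ) : ‖f (y₀ + ∑ μ, v μ • e μ) - f y₀‖ ≤ lam * ∑ μ, (v μ : ℝ) :=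
  norm_sub_partial_le f hlip y₀ v Finset.univ

/-- coordinates of a cube point: `(y₀ + Σ_μ v_μ • e_μ) ν = y₀ ν + v ν`. [folklore] -/
theorem cubePt_apply (y₀ : Site d) (v : Fin d → ℕ) (ν : Fin d) : (y₀ + ∑ μ, v μ • e μ) ν = y₀ ν + (v ν : ℤ) := by
  classical
  rw [Pi.add_apply, Finset.sum_apply]
  congr 1
  have h : ∀ μ, (v μ • e μ) ν = if μ = ν then (v ν : ℤ) else 0 := by
    intro μ
    rw [Pi.smul_apply, e_apply]
    by_cases hμν : μ = ν
    · subst hμν; simp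
    · rw [if_neg (Ne.symm hμν), if_neg hμν, smul_zero]
  simp_rw [h]
  rw [Finset.sum_ite_eq' Finset.univ ν]
  simp

/-- the cube map `v ↦ y₀ + Σ_μ v_μ • e_μ` is injective (on `ℤ^d`, no side condition). [folklore] -/
theorem cubePt_injective (y₀ : Site d) : Function.Injective fun v : Fin d → ℕ => y₀ + ∑ μ, v μ • e μ := by
  intro v v' h
  funext ν
  have hν := congr_fun h ν
  simp only [cubePt_apply, add_right_inj, Nat.cast_inj] at hν
  exact hν

/-- cube points with `v_μ ≤ r` lie in the order-cube `Finset.Icc y₀ (y₀ + r)`. [folklore] -/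
theorem cubePt_mem_Icc (y₀ : Site d) {r : ℕ} {v : Fin d → ℕ} (hv : ∀ μ, v μ ≤ r) :
    (y₀ + ∑ μ, v μ • e μ) ∈ Finset.Icc y₀ (y₀ + fun _ => (r : ℤ)) := by
  rw [Finset.mem_Icc]
  constructor
  · intro ν; rw [cubePt_apply]; simp
  · intro ν; rw [cubePt_apply]; change y₀ ν + (v ν : ℤ) ≤ y₀ ν + (r : ℤ); have := hv ν; omega

/-- a point of the order-cube `Icc y₀ (y₀ + r)` IS a cube point with `v_μ ≤ r`. [folklore] -/
theorem exists_cubePt_of_mem_Icc (y₀ : Site d) {r : ℕ} {x : Site d} (hx : x ∈ Finset.Icc y₀ (y₀ + fun _ => (r : ℤ))) :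
    ∃ v : Fin d → ℕ, (∀ μ, v μ ≤ r) ∧ x = y₀ + ∑ μ, v μ • e μ := by
  rw [Finset.mem_Icc] at hx
  obtain ⟨h1, h2⟩ := hx
  refine ⟨fun μ => (x μ - y₀ μ).toNat, fun μ => ?_, ?_⟩
  · have a := h1 μ; have b := h2 μ
    simp only [Pi.add_apply] at b
    have : x μ - y₀ μ ≤ r := by linarith
    exact_mod_cast (Int.toNat_le.mpr this : (x μ - y₀ μ).toNat ≤ r)
  · funext ν
    rw [cubePt_apply]
    have a := h1 ν
    rw [Int.toNat_of_nonneg (sub_nonneg.mpr a)]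
    ring

/-- **`(r+1)^d · (‖f x₀‖ − 2d·r·λ)² ≤ Σ_{x ∈ F} ‖f x‖²`** for every cube `Icc y₀ (y₀ + r) ⊆ F` CONTAINING `x₀`, `λ ≥ 0`,
`2d·r·λ ≤ ‖f x₀‖`: every value on the cube has norm `≥ ‖f x₀‖ − 2d·r·λ` (two cube diagonals through the corner `y₀`), and the
cube has `(r+1)^d` points. [folklore] -/
theorem card_mul_sq_le_sum_sq (f : Site d → E) {lam : ℝ} (hlam : 0 ≤ lam)
    (hlip : ∀ (x : Site d) (μ : Fin d), ‖f (x + e μ) - f x‖ ≤ lam)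
    {y₀ x₀ : Site d} {r : ℕ} {F : Finset (Site d)} (hF : Finset.Icc y₀ (y₀ + fun _ => (r : ℤ)) ⊆ F)
    (hx₀ : x₀ ∈ Finset.Icc y₀ (y₀ + fun _ => (r : ℤ))) (hm : 2 * (d : ℝ) * r * lam ≤ ‖f x₀‖) :
    ((r : ℝ) + 1) ^ d * (‖f x₀‖ - 2 * d * r * lam) ^ 2 ≤ ∑ x ∈ F, ‖f x‖ ^ 2 := by
  classical
  have hm0 : 0 ≤ ‖f x₀‖ - 2 * d * r * lam := sub_nonneg.mpr hm
  set B : Finset (Fin d → ℕ) := Fintype.piFinset fun _ : Fin d => Finset.range (r + 1) with hB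
  have hBmem : ∀ v ∈ B, ∀ μ, v μ ≤ r := fun v hv μ =>
    Nat.lt_succ_iff.mp (Finset.mem_range.mp (Fintype.mem_piFinset.mp hv μ))
  have hcard : B.card = (r + 1) ^ d := by
    rw [hB, Fintype.card_piFinset]
    simp [Finset.card_range, Finset.prod_const, Finset.card_univ, Fintype.card_fin]
  -- the bound `Σ v ≤ d r` on the cube
  have hsumle : ∀ v : Fin d → ℕ, (∀ μ, v μ ≤ r) → (∑ μ, (v μ : ℝ)) ≤ d * r := by
    intro v hv
    calc (∑ μ, (v μ : ℝ)) ≤ ∑ _μ : Fin d, (r : ℝ) := Finset.sum_le_sum fun μ _ => by exact_mod_cast hv μ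
      _ = d * r := by simp [Finset.sum_const, Finset.card_univ, Fintype.card_fin]
  -- `x₀` itself is a cube point
  obtain ⟨v₀, hv₀, hx₀eq⟩ := exists_cubePt_of_mem_Icc y₀ hx₀
  have h0 : ‖f x₀ - f y₀‖ ≤ lam * (d * r) := by
    rw [hx₀eq]; exact (norm_sub_cubePt_le f hlip y₀ v₀).trans (mul_le_mul_of_nonneg_left (hsumle v₀ hv₀) hlam)
  -- every cube value is at least `‖f x₀‖ − 2d·r·λ`
  have hval : ∀ v ∈ B, (‖f x₀‖ - 2 * d * r * lam) ^ 2 ≤ ‖f (y₀ + ∑ μ, v μ • e μ)‖ ^ 2 := by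
    intro v hv
    have h1 : ‖f (y₀ + ∑ μ, v μ • e μ) - f y₀‖ ≤ lam * (d * r) :=
      (norm_sub_cubePt_le f hlip y₀ v).trans (mul_le_mul_of_nonneg_left (hsumle v (hBmem v hv)) hlam)
    have h2 : ‖f x₀‖ - ‖f (y₀ + ∑ μ, v μ • e μ)‖ ≤ ‖f x₀ - f (y₀ + ∑ μ, v μ • e μ)‖ := norm_sub_norm_le _ _
    have h3 : ‖f x₀ - f (y₀ + ∑ μ, v μ • e μ)‖ ≤ ‖f x₀ - f y₀‖ + ‖f (y₀ + ∑ μ, v μ • e μ) - f y₀‖ := by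
      calc ‖f x₀ - f (y₀ + ∑ μ, v μ • e μ)‖ = ‖(f x₀ - f y₀) - (f (y₀ + ∑ μ, v μ • e μ) - f y₀)‖ := by congr 1; abel
        _ ≤ ‖f x₀ - f y₀‖ + ‖f (y₀ + ∑ μ, v μ • e μ) - f y₀‖ := norm_sub_le _ _
    have h4 : ‖f x₀‖ - 2 * d * r * lam ≤ ‖f (y₀ + ∑ μ, v μ • e μ)‖ := by linarith
    exact pow_le_pow_left₀ hm0 h4 2
  have hinj : Set.InjOn (fun v : Fin d → ℕ => y₀ + ∑ μ, v μ • e μ) ↑B := (cubePt_injective y₀).injOn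
  have himg : B.image (fun v : Fin d → ℕ => y₀ + ∑ μ, v μ • e μ) ⊆ F := by
    intro x hx
    obtain ⟨v, hv, rfl⟩ := Finset.mem_image.mp hx
    exact hF (cubePt_mem_Icc y₀ (hBmem v hv))
  calc ((r : ℝ) + 1) ^ d * (‖f x₀‖ - 2 * d * r * lam) ^ 2 = ∑ _v ∈ B, (‖f x₀‖ - 2 * d * r * lam) ^ 2 := by
        rw [Finset.sum_const, hcard, nsmul_eq_mul]; push_cast; ring
    _ ≤ ∑ v ∈ B, ‖f (y₀ + ∑ μ, v μ • e μ)‖ ^ 2 := Finset.sum_le_sum hval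
    _ = ∑ x ∈ B.image (fun v : Fin d → ℕ => y₀ + ∑ μ, v μ • e μ), ‖f x‖ ^ 2 :=
        (Finset.sum_image (f := fun x => ‖f x‖ ^ 2) hinj).symm
    _ ≤ ∑ x ∈ F, ‖f x‖ ^ 2 := Finset.sum_le_sum_of_subset_of_nonneg himg fun x _ _ => sq_nonneg _

/-- **THE ℓ² → SUP INTERPOLATION ON `ℤ^d` (two-term form)**: `‖f x₀‖ ≤ 2d·r·λ + √(Σ_{x∈F} ‖f x‖²) ∕ √((r+1)^d)` for EVERY cube
`Icc y₀ (y₀ + r) ⊆ F` containing `x₀` — a step-Lipschitz field with small ℓ²-energy on `F` is small pointwise; the consumer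
optimises `r` (≈ `(√Σ∕(dλ))^{2/(d+2)}`). [folklore] -/
theorem norm_le_of_stepLipschitz_of_sum_sq (f : Site d → E) {lam : ℝ} (hlam : 0 ≤ lam)
    (hlip : ∀ (x : Site d) (μ : Fin d), ‖f (x + e μ) - f x‖ ≤ lam)
    {y₀ x₀ : Site d} {r : ℕ} {F : Finset (Site d)} (hF : Finset.Icc y₀ (y₀ + fun _ => (r : ℤ)) ⊆ F)
    (hx₀ : x₀ ∈ Finset.Icc y₀ (y₀ + fun _ => (r : ℤ))) :
    ‖f x₀‖ ≤ 2 * d * r * lam + Real.sqrt (∑ x ∈ F, ‖f x‖ ^ 2) / Real.sqrt (((r : ℝ) + 1) ^ d) := by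
  have hpos : 0 < Real.sqrt (((r : ℝ) + 1) ^ d) := Real.sqrt_pos.mpr (by positivity)
  by_cases hm : 2 * (d : ℝ) * r * lam ≤ ‖f x₀‖
  · have h := card_mul_sq_le_sum_sq f hlam hlip hF hx₀ hm
    have hm0 : 0 ≤ ‖f x₀‖ - 2 * d * r * lam := sub_nonneg.mpr hm
    have key : (‖f x₀‖ - 2 * d * r * lam) * Real.sqrt (((r : ℝ) + 1) ^ d) ≤ Real.sqrt (∑ x ∈ F, ‖f x‖ ^ 2) := by
      have e1 : (‖f x₀‖ - 2 * d * r * lam) * Real.sqrt (((r : ℝ) + 1) ^ d)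
          = Real.sqrt ((‖f x₀‖ - 2 * d * r * lam) ^ 2 * ((r : ℝ) + 1) ^ d) := by
        rw [Real.sqrt_mul (sq_nonneg _), Real.sqrt_sq hm0]
      rw [e1]
      exact Real.sqrt_le_sqrt (by rw [mul_comm]; exact h)
    have h2 : ‖f x₀‖ - 2 * d * r * lam ≤ Real.sqrt (∑ x ∈ F, ‖f x‖ ^ 2) / Real.sqrt (((r : ℝ) + 1) ^ d) :=
      (le_div_iff₀ hpos).mpr key
    linarith
  · push Not at hm
    have : 0 ≤ Real.sqrt (∑ x ∈ F, ‖f x‖ ^ 2) / Real.sqrt (((r : ℝ) + 1) ^ d) := by positivity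
    linarith

end Lattice

/-! ## §2 The η-weighted energy norm dominates the two ℓ² sums; the two pointwise bounds -/

section Energy

variable {d : ℕ} {n : Type*} [Fintype n] [DecidableEq n]

/-- one direction of the bond term: `Σ_{x∈F} ‖Z x κ‖² ≤ dirSq Z F`. [folklore] -/
theorem sum_sq_dir_le (Z : Site d → Fin d → Matrix n n ℂ) (F : Finset (Site d)) (κ : Fin d) :
    ∑ x ∈ F, ‖Z x κ‖ ^ 2 ≤ dirSq Z F := by
  unfold dirSq
  exact Finset.sum_le_sum fun x _ => Finset.single_le_sum (f := fun κ' => ‖Z x κ'‖ ^ 2) (fun _ _ => sq_nonneg _)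
    (Finset.mem_univ κ)

/-- one plane of the curl term: `Σ_{x∈F} ‖(d_W Z)(x, π)‖² ≤ curlSq W Z F`. [folklore] -/
theorem sum_sq_curl_le (W : Site d → Fin d → (Matrix n n ℂ)ˣ) (Z : Site d → Fin d → Matrix n n ℂ) (F : Finset (Site d))
    (π : T4AveragingDeficitWall.Plane d) : ∑ x ∈ F, ‖curl W Z (x, π)‖ ^ 2 ≤ curlSq W Z F := by
  unfold curlSq
  exact Finset.sum_le_sum fun x _ => Finset.single_le_sum (f := fun π' => ‖curl W Z (x, π')‖ ^ 2) (fun _ _ => sq_nonneg _)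
    (Finset.mem_univ π)

/-- **POINTWISE BOUND ON THE DISCREPANCY DIRECTION FROM THE ENERGY NORM**: if `Z(·, κ)` is step-Lipschitz with constant `λ ≥ 0`
and the cube `Icc y₀ (y₀ + r) ⊆ F` contains `x₀`, then `‖Z x₀ κ‖ ≤ 2d·r·λ + L^k·energyNormW L k W Z F ∕ √((r+1)^d)` (`L ≥ 1`).
The consumer optimises `r`. [folklore] -/
theorem norm_dir_le_of_energyNormW {L : ℕ} (hL : 1 ≤ L) (k : ℕ) (W : Site d → Fin d → (Matrix n n ℂ)ˣ)
    (Z : Site d → Fin d → Matrix n n ℂ) (κ : Fin d) {lam : ℝ} (hlam : 0 ≤ lam)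
    (hlip : ∀ (x : Site d) (μ : Fin d), ‖Z (x + e μ) κ - Z x κ‖ ≤ lam)
    {y₀ x₀ : Site d} {r : ℕ} {F : Finset (Site d)} (hF : Finset.Icc y₀ (y₀ + fun _ => (r : ℤ)) ⊆ F)
    (hx₀ : x₀ ∈ Finset.Icc y₀ (y₀ + fun _ => (r : ℤ))) :
    ‖Z x₀ κ‖ ≤ 2 * d * r * lam + (L : ℝ) ^ k * energyNormW L k W Z F / Real.sqrt (((r : ℝ) + 1) ^ d) := by
  have h1 := norm_le_of_stepLipschitz_of_sum_sq (fun x => Z x κ) hlam hlip hF hx₀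
  have hE := energyNormW_nonneg L k W Z F
  have hLk : 0 ≤ (L : ℝ) ^ k := pow_nonneg (Nat.cast_nonneg L) k
  have h2 : Real.sqrt (∑ x ∈ F, ‖Z x κ‖ ^ 2) ≤ (L : ℝ) ^ k * energyNormW L k W Z F := by
    calc Real.sqrt (∑ x ∈ F, ‖Z x κ‖ ^ 2) ≤ Real.sqrt (((L : ℝ) ^ k) ^ 2 * energyNormW L k W Z F ^ 2) :=
          Real.sqrt_le_sqrt (((sum_sq_dir_le Z F κ).trans (dirSq_le_pow_sq_mul_energyNormW_sq hL k W Z F)))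
      _ = (L : ℝ) ^ k * energyNormW L k W Z F := by
          rw [← mul_pow, Real.sqrt_sq (mul_nonneg hLk hE)]
  have hpos : 0 < Real.sqrt (((r : ℝ) + 1) ^ d) := Real.sqrt_pos.mpr (by positivity)
  have h3 := div_le_div_of_nonneg_right h2 hpos.le
  linarith

/-- **POINTWISE BOUND ON THE DRESSED CURL OF THE DISCREPANCY FROM THE ENERGY NORM**: if `x ↦ (d_W Z)(x, π)` is step-Lipschitz with
constant `λ′ ≥ 0` and the cube `Icc y₀ (y₀ + r) ⊆ F` contains `x₀`, then `‖(d_W Z)(x₀, π)‖ ≤ 2d·r·λ′ + energyNormW L k W Z F ∕ √((r+1)^d)`.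
The consumer optimises `r`. [folklore] -/
theorem norm_curl_le_of_energyNormW (L k : ℕ) (W : Site d → Fin d → (Matrix n n ℂ)ˣ) (Z : Site d → Fin d → Matrix n n ℂ)
    (π : T4AveragingDeficitWall.Plane d) {lam : ℝ} (hlam : 0 ≤ lam)
    (hlip : ∀ (x : Site d) (μ : Fin d), ‖curl W Z (x + e μ, π) - curl W Z (x, π)‖ ≤ lam)
    {y₀ x₀ : Site d} {r : ℕ} {F : Finset (Site d)} (hF : Finset.Icc y₀ (y₀ + fun _ => (r : ℤ)) ⊆ F)
    (hx₀ : x₀ ∈ Finset.Icc y₀ (y₀ + fun _ => (r : ℤ))) :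
    ‖curl W Z (x₀, π)‖ ≤ 2 * d * r * lam + energyNormW L k W Z F / Real.sqrt (((r : ℝ) + 1) ^ d) := by
  have h1 := norm_le_of_stepLipschitz_of_sum_sq (fun x => curl W Z (x, π)) hlam hlip hF hx₀
  have hE := energyNormW_nonneg L k W Z F
  have h2 : Real.sqrt (∑ x ∈ F, ‖curl W Z (x, π)‖ ^ 2) ≤ energyNormW L k W Z F := by
    calc Real.sqrt (∑ x ∈ F, ‖curl W Z (x, π)‖ ^ 2) ≤ Real.sqrt (energyNormW L k W Z F ^ 2) :=
          Real.sqrt_le_sqrt ((sum_sq_curl_le W Z F π).trans (curlSq_le_energyNormW_sq L k W Z F))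
      _ = energyNormW L k W Z F := Real.sqrt_sq hE
  have hpos : 0 < Real.sqrt (((r : ℝ) + 1) ^ d) := Real.sqrt_pos.mpr (by positivity)
  have h3 := div_le_div_of_nonneg_right h2 hpos.le
  linarith

end Energy

/-! ## §3 BY NAME from row NE3's root T-E_w♯ -/

section Root

variable {d : ℕ} {n : Type*} [Fintype n] [DecidableEq n]

/-- **WHAT T-E_w♯ GIVES POINTWISE, BY NAME.**  Under row NE3's root `NE3EnergyRateWSup d 𝒞 L N b g C s dom` (`L ≥ 1`), for every
`k ≥ 1`, admissible datum `V`, run-A minimiser `UA` (level `k`) and REGULAR run-B minimiser `UB` (level `k+1`) there is a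
representation `gaugeAct u UA = vary (rescale L (bavg L UB)) Z 1` (unitary periodic `u`, skew periodic `Z`) with the root's sup
conjunct AND the two interpolation bounds of §2 with `energyNormW ≤ C·residualScale d L N b g k`: for every cube
`Icc y₀ (y₀ + r) ⊆ periodBox (N L^k)` containing `x₀`, every `κ`, `π` and every step-Lipschitz constant `λ` of `Z(·, κ)` resp. `λ′` of
`(d_W Z)(·, π)` (W = the averaged run-B minimiser) that the pair happens to have,
`‖Z x₀ κ‖ ≤ 2d·r·λ + L^k·C·residualScale_k ∕ √((r+1)^d)` and `‖(d_W Z)(x₀, π)‖ ≤ 2d·r·λ′ + C·residualScale_k ∕ √((r+1)^d)`.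
HONEST: the Lipschitz constants are NOT supplied by T-E_w♯ (for the U-slot they must become conjuncts of the root — regular-gauge TYPE
bounds on the discrepancy, cf. the sup conjunct's own supplier `NE3SupControl`); nothing of NE3 is discharged. [folklore] -/
theorem pointwise_of_ne3EnergyRateWSup {𝒞 : ℕ → Set (Site d → Fin d → (Matrix n n ℂ)ˣ)} {L N : ℕ} (hL : 1 ≤ L)
    {b g C s : ℝ} {dom : Set (Site d → Fin d → (Matrix n n ℂ)ˣ)} (h : NE3EnergyRateWSup d 𝒞 L N b g C s dom)
    {k : ℕ} (hk : 1 ≤ k) {V : Site d → Fin d → (Matrix n n ℂ)ˣ} (hV : V ∈ dom)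
    {UA UB : Site d → Fin d → (Matrix n n ℂ)ˣ} (hA : IsMinimiser d 𝒞 L N k V UA) (hB : IsMinimiser d 𝒞 L N (k + 1) V UB)
    (hreg : Regular d L N b g (k + 1) UB) :
    ∃ (u : Site d → (Matrix n n ℂ)ˣ) (Z : Site d → Fin d → Matrix n n ℂ),
      IsUnitarySite u ∧ IsPeriodicSite u ((N * L ^ k : ℕ) : ℤ) ∧ IsSkewDir Z ∧ IsPeriodicDir Z ((N * L ^ k : ℕ) : ℤ) ∧
      gaugeAct u UA = vary (rescale L (bavg L UB)) Z 1 ∧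
      (∀ (x : Site d) (κ : Fin d), ‖Z x κ‖ ≤ s * ((L : ℝ)⁻¹) ^ k) ∧
      (∀ (y₀ x₀ : Site d) (r : ℕ), Finset.Icc y₀ (y₀ + fun _ => (r : ℤ)) ⊆ periodBox (d := d) (N * L ^ k) →
        x₀ ∈ Finset.Icc y₀ (y₀ + fun _ => (r : ℤ)) →
        (∀ (κ : Fin d) (lam : ℝ), 0 ≤ lam → (∀ (x : Site d) (μ : Fin d), ‖Z (x + e μ) κ - Z x κ‖ ≤ lam) →
          ‖Z x₀ κ‖ ≤ 2 * d * r * lam + (L : ℝ) ^ k * (C * residualScale d L N b g k) / Real.sqrt (((r : ℝ) + 1) ^ d)) ∧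
        (∀ (π : T4AveragingDeficitWall.Plane d) (lam : ℝ), 0 ≤ lam →
          (∀ (x : Site d) (μ : Fin d), ‖curl (rescale L (bavg L UB)) Z (x + e μ, π) - curl (rescale L (bavg L UB)) Z (x, π)‖ ≤ lam) →
          ‖curl (rescale L (bavg L UB)) Z (x₀, π)‖
            ≤ 2 * d * r * lam + C * residualScale d L N b g k / Real.sqrt (((r : ℝ) + 1) ^ d))) := by
  obtain ⟨u, Z, hu, huP, hZ, hZP, hrep, hE, hsup⟩ := h k hk V hV UA UB hA hB hreg
  refine ⟨u, Z, hu, huP, hZ, hZP, hrep, hsup, fun y₀ x₀ r hF hx₀ => ⟨fun κ lam hlam hlip => ?_, fun π lam hlam hlip => ?_⟩⟩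
  · have h1 := norm_dir_le_of_energyNormW hL k (rescale L (bavg L UB)) Z κ hlam hlip hF hx₀
    have hpos : 0 < Real.sqrt (((r : ℝ) + 1) ^ d) := Real.sqrt_pos.mpr (by positivity)
    have hLk : 0 ≤ (L : ℝ) ^ k := pow_nonneg (Nat.cast_nonneg L) k
    have h2 : (L : ℝ) ^ k * energyNormW L k (rescale L (bavg L UB)) Z (periodBox (N * L ^ k))
        ≤ (L : ℝ) ^ k * (C * residualScale d L N b g k) := mul_le_mul_of_nonneg_left hE hLk
    have h3 := div_le_div_of_nonneg_right h2 hpos.le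
    linarith
  · have h1 := norm_curl_le_of_energyNormW L k (rescale L (bavg L UB)) Z π hlam hlip hF hx₀
    have hpos : 0 < Real.sqrt (((r : ℝ) + 1) ^ d) := Real.sqrt_pos.mpr (by positivity)
    have h3 := div_le_div_of_nonneg_right hE hpos.le
    linarith

end Root

end

end Summit.QuantumFields.BalabanUV.T4Continuum.NE7EtaSupFromEnergy
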